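import Mathlib
import HarnessLib
import Literature.NumberTheory.Sieve.BatemanHorn
import Summits.Parity.BatemanHorn.Theorems.AlmostPrimeZerosLinearCappedRepulsionJensenCount
import Summits.Parity.BatemanHorn.Theorems.AlmostPrimeZerosLinearCappedRepulsionStieltjes

/-!
# Near zone of the almost-prime zeros from the disc majorant (stub `stub_nearZone_of_majorant`)

Line `smooth-rough-lattice-acquisition` of crux stmt-Parity-11291
(`Summit.Parity.BatemanHorn.Theses.AlmostPrimeZeros.SystemZeroRepulsion`), stub S3.

Let `P_x = Σ_{0 ≤ n ≤ x} X^{s_f(n)} ∈ ℂ[X]` be the almost-prime polynomial of a Bateman–Horn system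
`f` (so `P_x(z) = S_x(z) = Σ_{n ≤ x} z^{s_f(n)}` and `P_x(1) = x + 1`), `L = log log x`.  From the
one-sided DISC MAJORANT `‖S_x(z)‖ ≤ A x (log x)^{k(Re z − 1)} e^{C‖z−1‖^{3/2}}` on `‖z − 1‖ ≤ 3L`
(the hypothesis) we deduce that the NEAR zone sum `Σ_{ρ : ‖1−ρ‖ < L} ‖1 − ρ‖⁻²` over the roots of
`P_x` (with multiplicity) is bounded for `x ≥ x₀'`.

Proof.  With `Λ := k·L`, `A' := log (max A 1) + max C 0` the disc majorant reads
`‖P_x(z)‖ ≤ ‖P_x(1)‖ exp(Λ Re(z−1) + A'(1+‖z−1‖)^{3/2})` on `‖z−1‖ ≤ 3L` (since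
`(log x)^{k(Re z−1)} = exp(k L (Re z − 1))`), and trivially
`‖P_x(z)‖ ≤ ‖P_x(1)‖ exp(d(1+‖z−1‖))` for all `z` with `d = Σ_n s_f(n)`.  The landed Jensen count
`stub_jensenCount` gives a zero-free disc `‖1−ρ‖ ≥ e^{−3A'}` and the near count
`N(t) ≤ A'(1+et)^{3/2}` for `et ≤ 3L`; restricted to the near multiset `{ρ : ‖1−ρ‖ < L}` the near
count is also a global count (nothing lies beyond `L`, and `eL ≤ 3L`), so the landed layer-cake
conversion `stub_stieltjes` (with `M = 0`, `R₁ = 1`) bounds the near sum by a constant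
`K(A')` independent of `x`.
-/

noncomputable section

namespace Summit.Parity.BatemanHorn.Cruxes.SystemZeroRepulsion.SmoothRoughLatticeAcquisition

open Polynomial
open Summit.Parity.BatemanHorn.Cruxes.LinearCappedRepulsion.JensenStieltjesMajorant

/-- `1 ≤ log log x` for `x ≥ 16`: `log 16 = 4 log 2 > 2.77 > e`. -/
private theorem one_le_loglog_of_sixteen_le {x : ℝ} (hx : 16 ≤ x) :
    1 ≤ Real.log (Real.log x) := by
  have h16 : Real.log 16 = 4 * Real.log 2 := by
    rw [show (16 : ℝ) = 2 ^ 4 by norm_num, Real.log_pow]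
    norm_num
  have hlog2 := Real.log_two_gt_d9
  have he := Real.exp_one_lt_d9
  have h1 : Real.exp 1 ≤ Real.log x := by
    have : Real.log 16 ≤ Real.log x := Real.log_le_log (by norm_num) hx
    linarith
  calc (1 : ℝ) = Real.log (Real.exp 1) := (Real.log_exp 1).symm
    _ ≤ Real.log (Real.log x) := Real.log_le_log (Real.exp_pos 1) h1

/-- Conversion of the disc majorant to the shape consumed by `stub_jensenCount`: for `X ≥ 0`,
`ℓ > 0`, `r ≥ 0`,
`A X ℓ^{κ(σ−1)} e^{C r^{3/2}} ≤ (X+1) exp(κ log ℓ (σ−1) + (log (max A 1) + max C 0)(1+r)^{3/2})`,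
because `ℓ^{κ(σ−1)} = exp(κ (σ−1) log ℓ)`, `A ≤ max A 1 = e^{log max(A,1)}` with
`0 ≤ log max(A,1) ≤ log max(A,1)·(1+r)^{3/2}`, and `C r^{3/2} ≤ (max C 0)(1+r)^{3/2}`. -/
private theorem majorant_le_exp {A C X ℓ r σ κ : ℝ} (hX : 0 ≤ X) (hℓ : 0 < ℓ) (hr : 0 ≤ r) :
    A * X * ℓ ^ (κ * (σ - 1)) * Real.exp (C * r ^ (3 / 2 : ℝ)) ≤
      (X + 1) * Real.exp (κ * Real.log ℓ * (σ - 1) +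
        (Real.log (max A 1) + max C 0) * (1 + r) ^ (3 / 2 : ℝ)) := by
  have hY : ℓ ^ (κ * (σ - 1)) = Real.exp (Real.log ℓ * (κ * (σ - 1))) := Real.rpow_def_of_pos hℓ _
  have hA1 : 0 < max A 1 := lt_max_of_lt_right one_pos
  have hlogA : 0 ≤ Real.log (max A 1) := Real.log_nonneg (le_max_right A 1)
  have hC0 : 0 ≤ max C 0 := le_max_right C 0
  have h1r : 1 ≤ (1 + r) ^ (3 / 2 : ℝ) := Real.one_le_rpow (by linarith) (by norm_num)
  have hr32 : r ^ (3 / 2 : ℝ) ≤ (1 + r) ^ (3 / 2 : ℝ) :=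
    Real.rpow_le_rpow hr (by linarith) (by norm_num)
  have h0 : 0 ≤ X * ℓ ^ (κ * (σ - 1)) * Real.exp (C * r ^ (3 / 2 : ℝ)) := by positivity
  have hexp : Real.log (max A 1) + Real.log ℓ * (κ * (σ - 1)) + C * r ^ (3 / 2 : ℝ) ≤
      κ * Real.log ℓ * (σ - 1) + (Real.log (max A 1) + max C 0) * (1 + r) ^ (3 / 2 : ℝ) := by
    have i1 : Real.log (max A 1) ≤ Real.log (max A 1) * (1 + r) ^ (3 / 2 : ℝ) :=
      le_mul_of_one_le_right hlogA h1r
    have i2 : C * r ^ (3 / 2 : ℝ) ≤ max C 0 * r ^ (3 / 2 : ℝ) :=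
      mul_le_mul_of_nonneg_right (le_max_left C 0) (Real.rpow_nonneg hr _)
    have i3 : max C 0 * r ^ (3 / 2 : ℝ) ≤ max C 0 * (1 + r) ^ (3 / 2 : ℝ) :=
      mul_le_mul_of_nonneg_left hr32 hC0
    nlinarith [i1, i2, i3]
  calc A * X * ℓ ^ (κ * (σ - 1)) * Real.exp (C * r ^ (3 / 2 : ℝ))
      = A * (X * ℓ ^ (κ * (σ - 1)) * Real.exp (C * r ^ (3 / 2 : ℝ))) := by ring
    _ ≤ max A 1 * (X * ℓ ^ (κ * (σ - 1)) * Real.exp (C * r ^ (3 / 2 : ℝ))) :=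
        mul_le_mul_of_nonneg_right (le_max_left A 1) h0
    _ = X * Real.exp (Real.log (max A 1) + Real.log ℓ * (κ * (σ - 1)) + C * r ^ (3 / 2 : ℝ)) := by
        rw [Real.exp_add, Real.exp_add, Real.exp_log hA1, hY]; ring
    _ ≤ (X + 1) * Real.exp (κ * Real.log ℓ * (σ - 1) +
          (Real.log (max A 1) + max C 0) * (1 + r) ^ (3 / 2 : ℝ)) :=
        mul_le_mul (by linarith) (Real.exp_le_exp.2 hexp) (Real.exp_pos _).le (by linarith)

/-- The trivial global majorant of a sum of powers: if `0 ≤ s(n) ≤ d` on `S` then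
`‖Σ_{n ∈ S} z^{s(n)}‖ ≤ #S · exp(d (1 + ‖z − 1‖))`, from `‖z‖ ≤ 1 + ‖z−1‖ ≤ e^{‖z−1‖}`. -/
private theorem norm_sum_pow_le {ι : Type*} (S : Finset ι) (s : ι → ℕ) {d : ℝ} (hd0 : 0 ≤ d)
    (hd : ∀ n ∈ S, (s n : ℝ) ≤ d) (z : ℂ) :
    ‖∑ n ∈ S, z ^ (s n)‖ ≤ (S.card : ℝ) * Real.exp (d * (1 + ‖z - 1‖)) := by
  have hz : ‖z‖ ≤ 1 + ‖z - 1‖ := by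
    have h := norm_sub_norm_le z 1
    rw [norm_one] at h
    linarith
  have hterm : ∀ n ∈ S, ‖z ^ (s n)‖ ≤ Real.exp (d * (1 + ‖z - 1‖)) := by
    intro n hn
    rw [norm_pow]
    calc ‖z‖ ^ (s n) ≤ (1 + ‖z - 1‖) ^ (s n) := pow_le_pow_left₀ (norm_nonneg _) hz _
      _ ≤ (Real.exp ‖z - 1‖) ^ (s n) :=
          pow_le_pow_left₀ (by positivity)
            (by have := Real.add_one_le_exp ‖z - 1‖; linarith) _
      _ = Real.exp ((s n : ℝ) * ‖z - 1‖) := (Real.exp_nat_mul _ _).symm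
      _ ≤ Real.exp (d * (1 + ‖z - 1‖)) :=
          Real.exp_le_exp.2 (mul_le_mul (hd n hn) (by linarith) (norm_nonneg _) hd0)
  calc ‖∑ n ∈ S, z ^ (s n)‖ ≤ ∑ n ∈ S, ‖z ^ (s n)‖ := norm_sum_le _ _
    _ ≤ ∑ n ∈ S, Real.exp (d * (1 + ‖z - 1‖)) := Finset.sum_le_sum hterm
    _ = (S.card : ℝ) * Real.exp (d * (1 + ‖z - 1‖)) := by
        rw [Finset.sum_const, nsmul_eq_mul]

/-- The counting input for the layer-cake conversion, restricted to the NEAR multiset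
`S' = {ρ ∈ roots P : ‖1 − ρ‖ < L}` (`L ≥ 1`): from the disc majorant on `‖z − 1‖ ≤ 3L` and a
global majorant, `stub_jensenCount` gives the zero-free disc `‖1 − ρ‖ ≥ e^{−3A'}` and the near
count `N(t) ≤ A'(1+et)^{3/2}` (`et ≤ 3L`); on `S'` the latter holds for `et ≤ 1` and, as a global
count, for every `t > 0` (for `et > 3L` one has `t > L`, so the count is that at `t = L`, where
`eL ≤ 3L`). -/
private theorem near_counts {P : ℂ[X]} {L A' Λ Λ' : ℝ} (hL : 1 ≤ L) (hA' : 0 ≤ A') (hΛ : 0 ≤ Λ)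
    (hΛ' : 0 ≤ Λ') (hP1 : P.eval 1 ≠ 0)
    (hdisc : ∀ z : ℂ, ‖z - 1‖ ≤ 3 * L →
      ‖P.eval z‖ ≤ ‖P.eval 1‖ * Real.exp (Λ * (z.re - 1) + A' * (1 + ‖z - 1‖) ^ (3 / 2 : ℝ)))
    (hglob : ∀ z : ℂ, ‖P.eval z‖ ≤
      ‖P.eval 1‖ * Real.exp (Λ' * (1 + ‖z - 1‖) + 0 * (1 + ‖z - 1‖) ^ (3 / 2 : ℝ))) :
    (∀ ρ ∈ P.roots.filter (fun ρ : ℂ => ‖(1 : ℂ) - ρ‖ < L),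
        Real.exp (-(3 * A')) ≤ ‖(1 : ℂ) - ρ‖) ∧
    (∀ t : ℝ, 0 < t → Real.exp 1 * t ≤ 1 →
      (((P.roots.filter (fun ρ : ℂ => ‖(1 : ℂ) - ρ‖ < L)).filter
          fun ρ : ℂ => ‖(1 : ℂ) - ρ‖ ≤ t).card : ℝ) ≤ A' * (1 + Real.exp 1 * t) ^ (3 / 2 : ℝ)) ∧
    (∀ t : ℝ, 0 < t →
      (((P.roots.filter (fun ρ : ℂ => ‖(1 : ℂ) - ρ‖ < L)).filter
          fun ρ : ℂ => ‖(1 : ℂ) - ρ‖ ≤ t).card : ℝ) ≤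
        0 * (1 + Real.exp 1 * t) + A' * (1 + Real.exp 1 * t) ^ (3 / 2 : ℝ)) := by
  obtain ⟨hfree, hnear, -⟩ :=
    stub_jensenCount P Λ Λ' (3 * L) A' 0 hP1 hΛ hΛ' (by linarith) hA' le_rfl hdisc hglob
  set S := P.roots.filter (fun ρ : ℂ => ‖(1 : ℂ) - ρ‖ < L) with hS
  have hsub : ∀ t : ℝ, ((S.filter fun ρ : ℂ => ‖(1 : ℂ) - ρ‖ ≤ t).card : ℝ) ≤
      ((P.roots.filter fun ρ : ℂ => ‖(1 : ℂ) - ρ‖ ≤ t).card : ℝ) := by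
    intro t
    exact_mod_cast Multiset.card_le_card (Multiset.filter_le_filter _ (Multiset.filter_le _ _))
  have hL0 : 0 < L := by linarith
  have he3 : Real.exp 1 ≤ 3 := by
    have := Real.exp_one_lt_d9
    linarith
  have he0 : 0 < Real.exp 1 := Real.exp_pos 1
  have heL : Real.exp 1 * L ≤ 3 * L := mul_le_mul_of_nonneg_right he3 hL0.le
  refine ⟨fun ρ hρ => hfree ρ (Multiset.mem_of_le (Multiset.filter_le _ _) hρ),
    fun t ht het => (hsub t).trans (hnear t ht (het.trans (by linarith))), fun t ht => ?_⟩
  rw [zero_mul, zero_add]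
  by_cases hc : Real.exp 1 * t ≤ 3 * L
  · exact (hsub t).trans (hnear t ht hc)
  · have hLt : L < t := by
      by_contra h
      have htL : t ≤ L := le_of_not_gt h
      exact hc ((mul_le_mul_of_nonneg_left htL he0.le).trans heL)
    have h1 : (S.filter fun ρ : ℂ => ‖(1 : ℂ) - ρ‖ ≤ t) ≤
        P.roots.filter fun ρ : ℂ => ‖(1 : ℂ) - ρ‖ ≤ L :=
      calc (S.filter fun ρ : ℂ => ‖(1 : ℂ) - ρ‖ ≤ t) ≤ S := Multiset.filter_le _ _
        _ ≤ P.roots.filter fun ρ : ℂ => ‖(1 : ℂ) - ρ‖ ≤ L :=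
          Multiset.monotone_filter_right _ (fun ρ (h : ‖(1 : ℂ) - ρ‖ < L) => h.le)
    have h2 : ((S.filter fun ρ : ℂ => ‖(1 : ℂ) - ρ‖ ≤ t).card : ℝ) ≤
        ((P.roots.filter fun ρ : ℂ => ‖(1 : ℂ) - ρ‖ ≤ L).card : ℝ) := by
      exact_mod_cast Multiset.card_le_card h1
    have h3 := hnear L hL0 heL
    have h4 : A' * (1 + Real.exp 1 * L) ^ (3 / 2 : ℝ) ≤ A' * (1 + Real.exp 1 * t) ^ (3 / 2 : ℝ) := by
      refine mul_le_mul_of_nonneg_left ?_ hA'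
      exact Real.rpow_le_rpow (by positivity)
        (by nlinarith [mul_le_mul_of_nonneg_left hLt.le he0.le]) (by norm_num)
    linarith

/-- The core of the stub over an arbitrary exponent sequence `s : ℕ → ℕ`: for `x ≥ 16` (so that
`L = log log x ≥ 1`), the disc majorant `‖Σ_{n ≤ x} z^{s(n)}‖ ≤ A x (log x)^{k(Re z−1)} e^{C‖z−1‖^{3/2}}`
on `‖z − 1‖ ≤ 3L` implies that the near sum `Σ_{ρ : ‖1−ρ‖ < L} ‖1−ρ‖⁻²` over the roots of
`Σ_{n ≤ x} X^{s(n)}` is at most any constant `K` satisfying the conclusion of `stub_stieltjes` with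
parameters `(A', A', 0, e^{−3A'})`, `A' = log (max A 1) + max C 0`, `M = 0`, `R₁ = 1`. -/
private theorem near_core {A C K : ℝ}
    (hK : ∀ S : Multiset ℂ,
      (∀ ρ ∈ S, Real.exp (-(3 * (Real.log (max A 1) + max C 0))) ≤ ‖(1 : ℂ) - ρ‖) →
      (∀ t : ℝ, 0 < t → Real.exp 1 * t ≤ 1 →
        ((S.filter fun ρ : ℂ => ‖(1 : ℂ) - ρ‖ ≤ t).card : ℝ) ≤
          (Real.log (max A 1) + max C 0) * (1 + Real.exp 1 * t) ^ (3 / 2 : ℝ)) →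
      (∀ t : ℝ, 0 < t →
        ((S.filter fun ρ : ℂ => ‖(1 : ℂ) - ρ‖ ≤ t).card : ℝ) ≤
          0 * (1 + Real.exp 1 * t) +
            (Real.log (max A 1) + max C 0) * (1 + Real.exp 1 * t) ^ (3 / 2 : ℝ)) →
      (S.map fun ρ : ℂ => (‖(1 : ℂ) - ρ‖ ^ 2)⁻¹).sum ≤ K)
    (s : ℕ → ℕ) {x : ℕ} (hx : 16 ≤ x) (k : ℕ)
    (hmaj : ∀ z : ℂ, ‖z - 1‖ ≤ 3 * Real.log (Real.log (x : ℝ)) →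
      ‖∑ n ∈ Finset.range (x + 1), z ^ (s n)‖ ≤
        A * (x : ℝ) * (Real.log (x : ℝ)) ^ ((k : ℝ) * (z.re - 1)) *
          Real.exp (C * ‖z - 1‖ ^ (3 / 2 : ℝ))) :
    (((∑ n ∈ Finset.range (x + 1), (X : ℂ[X]) ^ (s n)).roots.filter
        (fun ρ : ℂ => ‖(1 : ℂ) - ρ‖ < Real.log (Real.log (x : ℝ)))).map
      (fun ρ : ℂ => (‖(1 : ℂ) - ρ‖ ^ 2)⁻¹)).sum ≤ K := by
  set A' : ℝ := Real.log (max A 1) + max C 0 with hA'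
  set L : ℝ := Real.log (Real.log (x : ℝ)) with hL
  set P : ℂ[X] := ∑ n ∈ Finset.range (x + 1), (X : ℂ[X]) ^ (s n) with hP
  have hx16 : (16 : ℝ) ≤ x := by exact_mod_cast hx
  have hL1 : 1 ≤ L := one_le_loglog_of_sixteen_le hx16
  have hlogx : 0 < Real.log (x : ℝ) := Real.log_pos (by linarith)
  have hA'0 : 0 ≤ A' := add_nonneg (Real.log_nonneg (le_max_right A 1)) (le_max_right C 0)
  have heval : ∀ z : ℂ, P.eval z = ∑ n ∈ Finset.range (x + 1), z ^ (s n) := by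
    intro z
    simp [hP, Polynomial.eval_finsetSum]
  have hP1 : P.eval 1 = (x : ℂ) + 1 := by
    rw [heval]
    simp
  have hnorm1 : ‖P.eval 1‖ = (x : ℝ) + 1 := by
    rw [hP1]
    exact_mod_cast Complex.norm_natCast (x + 1)
  have hP1ne : P.eval 1 ≠ 0 := norm_pos_iff.mp (by rw [hnorm1]; positivity)
  -- the disc majorant in the shape of `stub_jensenCount`, `Λ = k L`
  have hdisc : ∀ z : ℂ, ‖z - 1‖ ≤ 3 * L → ‖P.eval z‖ ≤
      ‖P.eval 1‖ * Real.exp ((k : ℝ) * L * (z.re - 1) + A' * (1 + ‖z - 1‖) ^ (3 / 2 : ℝ)) := by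
    intro z hz
    rw [heval, hnorm1]
    exact (hmaj z hz).trans (majorant_le_exp (Nat.cast_nonneg x) hlogx (norm_nonneg _))
  -- the trivial global majorant, `Λ' = d = Σ_n s(n)`, `B = 0`
  obtain ⟨d, hd0, hdle⟩ : ∃ d : ℝ, 0 ≤ d ∧ ∀ n ∈ Finset.range (x + 1), (s n : ℝ) ≤ d :=
    ⟨∑ n ∈ Finset.range (x + 1), (s n : ℝ), Finset.sum_nonneg fun n _ => Nat.cast_nonneg _,
      fun n hn => Finset.single_le_sum (fun m _ => Nat.cast_nonneg (s m)) hn⟩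
  have hglob : ∀ z : ℂ, ‖P.eval z‖ ≤
      ‖P.eval 1‖ * Real.exp (d * (1 + ‖z - 1‖) + 0 * (1 + ‖z - 1‖) ^ (3 / 2 : ℝ)) := by
    intro z
    rw [heval, hnorm1, zero_mul, add_zero]
    have h := norm_sum_pow_le (Finset.range (x + 1)) s hd0 hdle z
    rw [Finset.card_range] at h
    exact_mod_cast h
  obtain ⟨h1, h2, h3⟩ := near_counts hL1 hA'0 (mul_nonneg (Nat.cast_nonneg k) (by linarith))
    hd0 hP1ne hdisc hglob
  exact hK _ h1 h2 h3

/-- **S3 `stub_nearZone_of_majorant`** (NEAR zone from the one-sided disc majorant; Jensen at the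
free centre `1` + layer-cake summation, both imported from the landed line
`jensen-stieltjes-majorant` of crux `LinearCappedRepulsion`).  If for every Bateman–Horn system
`f` the almost-prime sum `S_x(z) = Σ_{n ≤ x} z^{s_f(n)}` satisfies
`‖S_x(z)‖ ≤ A x (log x)^{k(Re z−1)} e^{C‖z−1‖^{3/2}}` on `‖z − 1‖ ≤ 3 log log x` for `x ≥ x₀`,
then for every Bateman–Horn system the near-zone sum `Σ_{ρ : ‖1−ρ‖ < log log x} ‖1 − ρ‖⁻²` over
the roots (with multiplicity) of `P_x = Σ_{n ≤ x} X^{s_f(n)}` is bounded for `x ≥ x₀'`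
(`x₀' = max x₀ 16`; the constant is `K(A', A', 0, e^{−3A'})` of `stub_stieltjes`,
`A' = log (max A 1) + max C 0`). -/
theorem stub_nearZone_of_majorant :
    (∀ (k : ℕ) (f : Fin k → Polynomial ℤ), Literature.NumberTheory.Sieve.IsBatemanHornSystem f →
      ∃ A C : ℝ, ∃ x₀ : ℕ, ∀ x : ℕ, x₀ ≤ x → ∀ z : ℂ, ‖z - 1‖ ≤ 3 * Real.log (Real.log (x : ℝ)) →
        ‖(∑ n ∈ Finset.range (x + 1), (z : ℂ) ^ (∑ i, (((f i).eval (n : ℤ)).toNat.factorization.sum fun _ v => min v 2)))‖ ≤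
          A * (x : ℝ) * (Real.log (x : ℝ)) ^ ((k : ℝ) * ((z : ℂ).re - 1)) * Real.exp (C * ‖(z : ℂ) - 1‖ ^ (3 / 2 : ℝ))) →
    ∀ (k : ℕ) (f : Fin k → Polynomial ℤ), Literature.NumberTheory.Sieve.IsBatemanHornSystem f →
      ∃ C : ℝ, ∃ x₀ : ℕ, ∀ x : ℕ, x₀ ≤ x →
        ((((∑ n ∈ Finset.range (x + 1), (Polynomial.X : Polynomial ℂ) ^ (∑ i, (((f i).eval (n : ℤ)).toNat.factorization.sum fun _ v => min v 2)))).roots.filter (fun ρ : ℂ => ‖(1 : ℂ) - ρ‖ < Real.log (Real.log (x : ℝ)))).map (fun ρ : ℂ => (‖(1 : ℂ) - ρ‖ ^ 2)⁻¹)).sum ≤ C := by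
  intro hmaj k f hf
  obtain ⟨A, C, x₀, hACx⟩ := hmaj k f hf
  have hA'0 : 0 ≤ Real.log (max A 1) + max C 0 :=
    add_nonneg (Real.log_nonneg (le_max_right A 1)) (le_max_right C 0)
  obtain ⟨K, hK⟩ := stub_stieltjes (Real.log (max A 1) + max C 0) (Real.log (max A 1) + max C 0)
    0 (Real.exp (-(3 * (Real.log (max A 1) + max C 0)))) hA'0 hA'0 le_rfl (Real.exp_pos _)
  refine ⟨K, max x₀ 16, fun x hx => ?_⟩
  exact near_core (fun S h1 h2 h3 => hK S 0 1 le_rfl le_rfl (by norm_num) h1 h2 h3)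
    (fun n => ∑ i, (((f i).eval (n : ℤ)).toNat.factorization.sum fun _ v => min v 2))
    (le_of_max_le_right hx) k (hACx x (le_of_max_le_left hx))

/-- **Near zone from the disc majorant, PER STATISTIC** (public form of the core of S3, for the
class-by-class composition of the crux; lead c2, 2026-08-17).  For an arbitrary exponent sequence
`s : ℕ → ℕ` and any `k : ℕ`: if `‖Σ_{n ≤ x} z^{s(n)}‖ ≤ A x (log x)^{k(Re z−1)} e^{C‖z−1‖^{3/2}}` on
`‖z − 1‖ ≤ 3 log log x` for all `x ≥ x₀`, then the near-zone sum `Σ_{ρ : ‖1−ρ‖ < log log x} ‖1 − ρ‖⁻²`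
over the roots (with multiplicity) of `Σ_{n ≤ x} X^{s(n)}` is bounded by one constant for all
`x ≥ max x₀ 16` (the constant is `K(A', A', 0, e^{−3A'})` of `stub_stieltjes`,
`A' = log (max A 1) + max C 0`).  Unlike `stub_nearZone_of_majorant` this needs the majorant for ONE
sequence only, so a single system (or a single class of systems) can be fed to it.  Registered helper stub
`stub_nearZoneStat` of the crux (lead c2). -/
theorem stub_nearZoneStat :
    ∀ (s : ℕ → ℕ) (k : ℕ) (A C : ℝ) (x₀ : ℕ),
      (∀ x : ℕ, x₀ ≤ x → ∀ z : ℂ, ‖z - 1‖ ≤ 3 * Real.log (Real.log (x : ℝ)) →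
        ‖∑ n ∈ Finset.range (x + 1), z ^ (s n)‖ ≤
          A * (x : ℝ) * (Real.log (x : ℝ)) ^ ((k : ℝ) * (z.re - 1)) * Real.exp (C * ‖z - 1‖ ^ (3 / 2 : ℝ))) →
      ∃ K : ℝ, ∀ x : ℕ, max x₀ 16 ≤ x →
        (((∑ n ∈ Finset.range (x + 1), (Polynomial.X : Polynomial ℂ) ^ (s n)).roots.filter
            (fun ρ : ℂ => ‖(1 : ℂ) - ρ‖ < Real.log (Real.log (x : ℝ)))).map
          (fun ρ : ℂ => (‖(1 : ℂ) - ρ‖ ^ 2)⁻¹)).sum ≤ K := by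
  intro s k A C x₀ hmaj
  have hA'0 : 0 ≤ Real.log (max A 1) + max C 0 :=
    add_nonneg (Real.log_nonneg (le_max_right A 1)) (le_max_right C 0)
  obtain ⟨K, hK⟩ := stub_stieltjes (Real.log (max A 1) + max C 0) (Real.log (max A 1) + max C 0)
    0 (Real.exp (-(3 * (Real.log (max A 1) + max C 0)))) hA'0 hA'0 le_rfl (Real.exp_pos _)
  refine ⟨K, fun x hx => ?_⟩
  exact near_core (fun S h1 h2 h3 => hK S 0 1 le_rfl le_rfl (by norm_num) h1 h2 h3)
    s (le_of_max_le_right hx) k (hmaj x (le_of_max_le_left hx))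

end Summit.Parity.BatemanHorn.Cruxes.SystemZeroRepulsion.SmoothRoughLatticeAcquisition

end
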